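import Mathlib
import Summits.CriticalPhenomena.PercolationContinuityZ3.Theorems.FreeBoxPowerSaving.Negative.FreeBoxPowerSavingBounds
import Literature.Probability.Percolation.SharpnessDCTProofs

/-!
# Crux `PercNonProliferation.FreeBoxPowerSaving` (stmt-CriticalPhenomena-4447), line `tightness-collapse-typical-kmax` — stub `stub_logBoost`

Helper file for the crux skeleton
`Cruxes/FreeBoxPowerSaving/Lines/tightness-collapse-typical-kmax.lean`
(lead prover-line-stmt-CriticalPhenomena-4447-0).  Proves exactly the registered stub signature
`stub_logBoost` ("the tightness collapse: one bit per scale gives a power saving"); lands with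
`--supports stmt-CriticalPhenomena-4447`.

## The statement

Bond percolation `P_p` on `ℤ³`, free box `B = B(n) = box 3 n` (`|B| = (2n+1)³`).  For `u ∈ B` let
`N_u(ω)` be the number of vertices of `B` joined to `u` by an open path INSIDE `B`, and for real `t`
let `QG(n,t) = {∃ u ∈ B, N_u ≥ t}` ("some in-box piece has at least `t` vertices"),
`q(t) = P_p(QG(n,t))`.  Hypotheses (at a fixed `p`):
* (H1, size splitting) `q(3s) ≤ q(s)²` for every `n` and every real `s ≥ 1`;
* (H2) for some `a, ε > 0`, eventually in `n`, `q(n^{3-a}) ≤ 1 - ε`.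

Conclusion: for some `a' > 0` and `C`, eventually
`FA₂(p,n) = |B|⁻² Σ_{x,y ∈ B} P_p(x ↔ y in B) ≤ C n^{-a'}`; we take `a' = a/2`, `C = 2`.

## The argument

0. `a < 3`: otherwise `n^{3-a} ≤ 1 ≤ N_u` for `n ≥ 1`, so `QG(n, n^{3-a})` is sure and (H2) fails.
   Put `θ = max(1-ε, 0) ∈ [0,1)`.
1. ITERATION of (H1) (`LogBoost.iterate_sq`): `q(3^k t) ≤ q(t)^{2^k}` for `t ≥ 1`.
2. FIRST MOMENT (`LogBoost.sum_sum_measureReal_le`, stated for an arbitrary probability measure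
   and an arbitrary finite family of measurable events): for `t ≥ 0`, pointwise
   `N_x ≤ t + |B|·1_{QG(n,t)}` and `Σ_{y ∈ B} P_p(x ↔ y in B) = E N_x` (a finite sum of
   indicators), so `Σ_{x,y} P_p(x ↔ y in B) ≤ |B| t + |B|² q(t)`.
3. SCALES: fix `M ∈ ℕ`, `M ≥ 1`, with `1/M ≤ a/2`, and let `k = k(n) = ⌊log_{3^M} n⌋` (`Nat.log`),
   so `3^{kM} ≤ n < 3^{(k+1)M}`.  With `t = 3^k n^{3-a}`:
   `3^k n^{3-a} ≤ n^{1/M} n^{-a} n³ ≤ n^{-a/2} n³ ≤ n^{-a/2} |B|` (`LogBoost.scale_term_le`), and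
   `q(t) ≤ q(n^{3-a})^{2^k} ≤ θ^{2^k} ≤ ρ^{k+1} ≤ n^{-a/2}` with `ρ = (3^M)^{-a/2}`: the third step
   for `k` large because doubly-exponential decay beats geometric decay
   (`LogBoost.eventually_pow_two_pow_le`: `θ^m < ρ` for some `m`, and `m(k+1) ≤ 2^k` eventually),
   the last step from `n < (3^M)^{k+1}` (`LogBoost.rho_pow_le`).  Hence `FA₂(n) ≤ 2 n^{-a/2}`
   for all large `n`.

Degenerate parameters: `ε ≥ 1` forces `q(n^{3-a}) = 0` eventually (fine, `θ = 0`); `p ∈ {0,1}`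
need no separate treatment (at `p = 1` hypothesis (H2) is unsatisfiable, consistent with
`FreeBoxPowerSavingNegative.false_at_one`).

Mathlib API: `integral_finsetSum`, `integral_indicator_one`, `integral_mono`, `Nat.log`
(`Nat.pow_log_le_self`, `Nat.lt_pow_succ_log_self`, `Nat.le_log_of_pow_le`),
`Real.pow_rpow_inv_natCast`, `Real.rpow_pow_comm`, `Real.rpow_le_rpow_of_nonpos`,
`exists_pow_lt_of_lt_one`, `tendsto_pow_const_div_const_pow_of_one_lt`.
Tree API: `card_box_real`, `card_box_pos`, `openConnIn_self_eq_univ`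
(`FreeBoxPowerSavingNegative`), `DCT16.measurableSet_openConnIn`, `zero_mem_box`.
-/

noncomputable section

open MeasureTheory Filter
open Literature.Probability.Percolation Literature.Probability.LatticeModels
open scoped Topology Classical BigOperators

namespace Summit.CriticalPhenomena.PercolationContinuityZ3.FreeBoxPowerSavingLine

open Summit.CriticalPhenomena.PercolationContinuityZ3.FreeBoxPowerSavingNegative (card_box_real
  card_box_pos openConnIn_self_eq_univ)

namespace LogBoost

/-! ### Step 1: iterating the size-splitting inequality -/

/-- **Iteration.** If `f ≥ 0` and `f(3s) ≤ f(s)²` for all real `s ≥ 1`, then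
`f(3^k t) ≤ f(t)^{2^k}` for `t ≥ 1` and every `k` (induction on `k`; `3^{k+1} t = 3·(3^k t)` and
`3^k t ≥ 1`). -/
theorem iterate_sq (f : ℝ → ℝ) (hf0 : ∀ s, 0 ≤ f s) (hf : ∀ s, 1 ≤ s → f (3 * s) ≤ f s ^ 2)
    {t : ℝ} (ht : 1 ≤ t) (k : ℕ) : f (3 ^ k * t) ≤ f t ^ (2 ^ k) := by
  induction k with
  | zero => simp
  | succ k ih =>
    have hk : (1 : ℝ) ≤ 3 ^ k * t :=
      one_le_mul_of_one_le_of_one_le (one_le_pow₀ (by norm_num)) ht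
    calc f (3 ^ (k + 1) * t) = f (3 * (3 ^ k * t)) := by congr 1; ring
      _ ≤ f (3 ^ k * t) ^ 2 := hf _ hk
      _ ≤ (f t ^ 2 ^ k) ^ 2 := pow_le_pow_left₀ (hf0 _) ih 2
      _ = f t ^ 2 ^ (k + 1) := by rw [← pow_mul, pow_succ]

/-! ### Step 2: the first-moment bound -/

/-- **First moment.** For a probability measure `μ`, a finite set `B` and events `E x y`
(`x, y ∈ B`), write `N_x(ω) = #{y ∈ B : ω ∈ E x y}` and `QG(t) = {∃ u ∈ B, N_u ≥ t}`.  Then for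
`t ≥ 0`, `Σ_{x,y ∈ B} μ(E x y) ≤ |B| t + |B|² μ(QG(t))`: indeed `Σ_y μ(E x y) = ∫ N_x dμ` and
pointwise `N_x ≤ t + |B| 1_{QG(t)}` (off `QG(t)` one has `N_x < t`, and always `N_x ≤ |B|`). -/
theorem sum_sum_measureReal_le {Ω ι : Type*} [MeasurableSpace Ω] (μ : Measure Ω)
    [IsProbabilityMeasure μ] (B : Finset ι) (E : ι → ι → Set Ω)
    (hE : ∀ x ∈ B, ∀ y ∈ B, MeasurableSet (E x y)) {t : ℝ} (ht : 0 ≤ t) :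
    ∑ x ∈ B, ∑ y ∈ B, μ.real (E x y) ≤
      (B.card : ℝ) * t + (B.card : ℝ) ^ 2 *
        μ.real {ω | ∃ u ∈ B, t ≤ ((B.filter fun y => ω ∈ E u y).card : ℝ)} := by
  set QG : Set Ω := {ω | ∃ u ∈ B, t ≤ ((B.filter fun y => ω ∈ E u y).card : ℝ)} with hQG
  -- `N_x` as a sum of indicators
  have hN_eq : ∀ (x : ι) (ω : Ω), ((B.filter fun y => ω ∈ E x y).card : ℝ) =
      ∑ y ∈ B, (E x y).indicator (1 : Ω → ℝ) ω := by
    intro x ω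
    rw [Finset.natCast_card_filter]
    refine Finset.sum_congr rfl fun y _ => ?_
    by_cases h : ω ∈ E x y <;> simp [h]
  -- measurability of `N_x` and of `QG(t)`
  have hN_meas : ∀ x ∈ B, Measurable fun ω => ((B.filter fun y => ω ∈ E x y).card : ℝ) := by
    intro x hx
    have h : (fun ω => ((B.filter fun y => ω ∈ E x y).card : ℝ)) =
        fun ω => ∑ y ∈ B, (E x y).indicator (1 : Ω → ℝ) ω := funext (hN_eq x)
    rw [h]
    exact Finset.measurable_sum _ fun y hy => measurable_one.indicator (hE x hx y hy)
  have hQG_meas : MeasurableSet QG := by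
    have h : QG = ⋃ u ∈ B, {ω | t ≤ ((B.filter fun y => ω ∈ E u y).card : ℝ)} := by
      ext ω; simp [hQG]
    rw [h]
    exact Finset.measurableSet_biUnion _ fun u hu =>
      measurableSet_le measurable_const (hN_meas u hu)
  -- the bound for one `x ∈ B`
  have hx_bound : ∀ x ∈ B, ∑ y ∈ B, μ.real (E x y) ≤ t + (B.card : ℝ) * μ.real QG := by
    intro x hx
    have hint : ∀ y ∈ B, Integrable ((E x y).indicator (1 : Ω → ℝ)) μ :=
      fun y hy => (integrable_const (1 : ℝ)).indicator (hE x hx y hy)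
    have hint_rhs : Integrable (fun ω => t + (B.card : ℝ) * QG.indicator (1 : Ω → ℝ) ω) μ :=
      (integrable_const t).add (((integrable_const (1 : ℝ)).indicator hQG_meas).const_mul _)
    have h1 : ∑ y ∈ B, μ.real (E x y) = ∫ ω, ∑ y ∈ B, (E x y).indicator (1 : Ω → ℝ) ω ∂μ := by
      rw [integral_finsetSum _ hint]
      exact Finset.sum_congr rfl fun y hy => (integral_indicator_one (hE x hx y hy)).symm
    have hptw : ∀ ω, ∑ y ∈ B, (E x y).indicator (1 : Ω → ℝ) ω ≤
        t + (B.card : ℝ) * QG.indicator (1 : Ω → ℝ) ω := by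
      intro ω
      rw [← hN_eq]
      by_cases hω : ω ∈ QG
      · rw [Set.indicator_of_mem hω, Pi.one_apply, mul_one]
        have : ((B.filter fun y => ω ∈ E x y).card : ℝ) ≤ B.card := by
          exact_mod_cast Finset.card_filter_le _ _
        linarith
      · rw [Set.indicator_of_notMem hω, mul_zero, add_zero]
        have : ¬ t ≤ ((B.filter fun y => ω ∈ E x y).card : ℝ) := fun h => hω ⟨x, hx, h⟩
        exact (not_le.1 this).le
    rw [h1]
    calc ∫ ω, ∑ y ∈ B, (E x y).indicator (1 : Ω → ℝ) ω ∂μ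
        ≤ ∫ ω, (t + (B.card : ℝ) * QG.indicator (1 : Ω → ℝ) ω) ∂μ :=
          integral_mono (integrable_finsetSum _ hint) hint_rhs hptw
      _ = t + (B.card : ℝ) * μ.real QG := by
          have hI : Integrable (fun ω => (B.card : ℝ) * QG.indicator (1 : Ω → ℝ) ω) μ :=
            ((integrable_const (1 : ℝ)).indicator hQG_meas).const_mul _
          rw [integral_add (integrable_const t) hI, integral_const, integral_const_mul,
            integral_indicator_one hQG_meas]
          simp
  calc ∑ x ∈ B, ∑ y ∈ B, μ.real (E x y) ≤ ∑ x ∈ B, (t + (B.card : ℝ) * μ.real QG) :=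
        Finset.sum_le_sum hx_bound
    _ = (B.card : ℝ) * t + (B.card : ℝ) ^ 2 * μ.real QG := by
        rw [Finset.sum_const, nsmul_eq_mul]; ring

/-! ### Step 3: real-analysis bookkeeping for the choice of scales -/

/-- Linear growth is eventually dominated by `2^k`: `c (k+1) ≤ 2^k` for all large `k`. -/
theorem eventually_mul_succ_le_two_pow (c : ℝ) :
    ∀ᶠ k : ℕ in atTop, c * ((k : ℝ) + 1) ≤ (2 : ℝ) ^ k := by
  have h := tendsto_pow_const_div_const_pow_of_one_lt 1 (one_lt_two : (1 : ℝ) < 2)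
  have hδ : (0 : ℝ) < 1 / (2 * (|c| + 1)) := by positivity
  filter_upwards [h.eventually (eventually_le_nhds hδ), eventually_ge_atTop 1] with k hk hk1
  rw [pow_one, div_le_div_iff₀ (by positivity) (by positivity), one_mul] at hk
  have hk1' : (1 : ℝ) ≤ k := by exact_mod_cast hk1
  have hc : c ≤ |c| := le_abs_self c
  nlinarith [mul_nonneg (sub_nonneg.2 hc) (by positivity : (0 : ℝ) ≤ (k : ℝ) + 1),
    mul_nonneg (abs_nonneg c) (sub_nonneg.2 hk1')]

/-- **Doubly-exponential decay beats geometric decay**: for `0 ≤ θ < 1` and `ρ > 0`,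
`θ^{2^k} ≤ ρ^{k+1}` for all large `k` (pick `m` with `θ^m < ρ`; then
`θ^{2^k} ≤ θ^{m(k+1)} ≤ ρ^{k+1}` once `m(k+1) ≤ 2^k`). -/
theorem eventually_pow_two_pow_le {θ ρ : ℝ} (hθ0 : 0 ≤ θ) (hθ1 : θ < 1) (hρ : 0 < ρ) :
    ∀ᶠ k : ℕ in atTop, θ ^ (2 ^ k) ≤ ρ ^ (k + 1) := by
  obtain ⟨m, hm⟩ := exists_pow_lt_of_lt_one hρ hθ1
  filter_upwards [eventually_mul_succ_le_two_pow (m : ℝ)] with k hk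
  have hk' : m * (k + 1) ≤ 2 ^ k := by exact_mod_cast hk
  calc θ ^ (2 ^ k) ≤ θ ^ (m * (k + 1)) := pow_le_pow_of_le_one hθ0 hθ1.le hk'
    _ = (θ ^ m) ^ (k + 1) := pow_mul θ m (k + 1)
    _ ≤ ρ ^ (k + 1) := pow_le_pow_left₀ (pow_nonneg hθ0 m) hm.le (k + 1)

/-- **The deterministic term.** For `M ≠ 0` with `1/M ≤ a/2`, `n ≥ 1` and `k = ⌊log_{3^M} n⌋`:
`3^k n^{3-a} ≤ n^{-a/2} n³` (since `3^{kM} ≤ n` gives `3^k ≤ n^{1/M} ≤ n^{a/2}`). -/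
theorem scale_term_le {a : ℝ} {M : ℕ} (hM : M ≠ 0) (hMa : (M : ℝ)⁻¹ ≤ a / 2) {n : ℕ}
    (hn : 1 ≤ n) :
    (3 : ℝ) ^ Nat.log (3 ^ M) n * (n : ℝ) ^ (3 - a) ≤ (n : ℝ) ^ (-(a / 2)) * (n : ℝ) ^ 3 := by
  set k := Nat.log (3 ^ M) n with hk
  have hn0 : (0 : ℝ) < n := by exact_mod_cast hn
  have hn1 : (1 : ℝ) ≤ n := by exact_mod_cast hn
  have hpow_nat : (3 ^ M) ^ k ≤ n := Nat.pow_log_le_self _ (by omega)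
  have hpow : ((3 : ℝ) ^ k) ^ M ≤ n := by
    rw [← pow_mul, mul_comm, pow_mul]
    exact_mod_cast hpow_nat
  have h3k : (3 : ℝ) ^ k ≤ (n : ℝ) ^ (a / 2) :=
    calc (3 : ℝ) ^ k = (((3 : ℝ) ^ k) ^ M) ^ ((M : ℝ)⁻¹) :=
          (Real.pow_rpow_inv_natCast (by positivity) hM).symm
      _ ≤ (n : ℝ) ^ ((M : ℝ)⁻¹) := Real.rpow_le_rpow (by positivity) hpow (by positivity)
      _ ≤ (n : ℝ) ^ (a / 2) := Real.rpow_le_rpow_of_exponent_le hn1 hMa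
  have hsplit : (n : ℝ) ^ (3 - a) = (n : ℝ) ^ (-a) * (n : ℝ) ^ 3 := by
    rw [show (3 : ℝ) - a = -a + 3 by ring, Real.rpow_add hn0, Real.rpow_ofNat]
  have hcomb : (n : ℝ) ^ (a / 2) * (n : ℝ) ^ (-a) = (n : ℝ) ^ (-(a / 2)) := by
    rw [← Real.rpow_add hn0]; congr 1; ring
  calc (3 : ℝ) ^ k * (n : ℝ) ^ (3 - a) = (3 : ℝ) ^ k * (n : ℝ) ^ (-a) * (n : ℝ) ^ 3 := by
        rw [hsplit, mul_assoc]
    _ ≤ (n : ℝ) ^ (a / 2) * (n : ℝ) ^ (-a) * (n : ℝ) ^ 3 := by gcongr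
    _ = (n : ℝ) ^ (-(a / 2)) * (n : ℝ) ^ 3 := by rw [hcomb]

/-- **The geometric term is a power of `n`.** For `a ≥ 0`, `M ≠ 0`, `n ≥ 1` and
`k = ⌊log_{3^M} n⌋`: `((3^M)^{-a/2})^{k+1} ≤ n^{-a/2}` (since `n < (3^M)^{k+1}`). -/
theorem rho_pow_le {a : ℝ} (ha : 0 ≤ a) {M : ℕ} (hM : M ≠ 0) {n : ℕ} (hn : 1 ≤ n) :
    (((3 : ℝ) ^ M) ^ (-(a / 2))) ^ (Nat.log (3 ^ M) n + 1) ≤ (n : ℝ) ^ (-(a / 2)) := by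
  have hn0 : (0 : ℝ) < n := by exact_mod_cast hn
  have hb : 1 < 3 ^ M := Nat.one_lt_pow hM (by norm_num)
  have hlt : n < (3 ^ M) ^ (Nat.log (3 ^ M) n + 1) := Nat.lt_pow_succ_log_self hb n
  have hle : (n : ℝ) ≤ ((3 : ℝ) ^ M) ^ (Nat.log (3 ^ M) n + 1) := by exact_mod_cast hlt.le
  rw [Real.rpow_pow_comm (by positivity)]
  exact Real.rpow_le_rpow_of_nonpos hn0 hle (by linarith)

end LogBoost

open LogBoost

set_option quotPrecheck false in
/-- `q[p, n, t] = P_p(QG(n,t))` — the probability that some vertex of `B(n)` is joined inside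
`B(n)` to at least `t` vertices of `B(n)`, spelled exactly as in the registered stub. -/
local notation "q[" p ", " n ", " t "]" =>
  (bondPercolation (zdGraph 3) p).real
    {ω | ∃ u ∈ box 3 n, (t : ℝ) ≤
      (((box 3 n).filter fun v => ω ∈ openConnIn ↑(box 3 n) u v).card : ℝ)}

/-- **stub_logBoost (the tightness collapse: one bit per scale ⟹ a power saving; every `p`).**
If size splitting `P_p(QG(n,3s)) ≤ P_p(QG(n,s))²` (`s ≥ 1`) holds at `p` and, for some
`a, ε > 0`, eventually `P_p(QG(n, n^{3-a})) ≤ 1 - ε`, then for `a' = a/2`, `C = 2`, eventually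
`FA₂(p, n) = |B(n)|⁻² Σ_{x,y ∈ B(n)} P_p(x ↔ y in B(n)) ≤ C n^{-a'}`.  Proof: module docstring
(iteration `q(3^k t) ≤ q(t)^{2^k}`, first moment `FA₂ ≤ t/|B| + q(t)`, scales
`t = 3^k n^{3-a}` with `k = ⌊log_{3^M} n⌋`, `1/M ≤ a/2`).
[cite: Hutchcroft2021, Thm 2.2–2.3 (mean ≍ typical largest cluster)] -/
theorem stub_logBoost :
    ∀ (p : unitInterval),
      (∀ (n : ℕ) (s : ℝ), 1 ≤ s →
        (bondPercolation (zdGraph 3) p).real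
            {ω | ∃ u ∈ box 3 n,
              3 * s ≤ (((box 3 n).filter fun v => ω ∈ openConnIn ↑(box 3 n) u v).card : ℝ)}
          ≤ ((bondPercolation (zdGraph 3) p).real
              {ω | ∃ u ∈ box 3 n,
                s ≤ (((box 3 n).filter fun v => ω ∈ openConnIn ↑(box 3 n) u v).card : ℝ)}) ^ 2) →
      ∀ (a ε : ℝ), 0 < a → 0 < ε →
        (∀ᶠ n : ℕ in atTop,
          (bondPercolation (zdGraph 3) p).real
              {ω | ∃ u ∈ box 3 n,
                (n : ℝ) ^ (3 - a) ≤
                  (((box 3 n).filter fun v => ω ∈ openConnIn ↑(box 3 n) u v).card : ℝ)}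
            ≤ 1 - ε) →
        ∃ a' C : ℝ, 0 < a' ∧ ∀ᶠ n : ℕ in atTop,
          (∑ x ∈ box 3 n, ∑ y ∈ box 3 n,
              (bondPercolation (zdGraph 3) p).real (openConnIn ↑(box 3 n) x y))
            / ((box 3 n).card : ℝ) ^ 2 ≤ C * (n : ℝ) ^ (-a') := by
  intro p h1 a ε ha hε h2
  -- (0) `N_u ≥ 1` for `u ∈ B(n)`; hence `a < 3`
  have hN1 : ∀ (n : ℕ) (u : Site 3), u ∈ box 3 n → ∀ ω : BondConfig (Site 3),
      (1 : ℝ) ≤ (((box 3 n).filter fun v => ω ∈ openConnIn ↑(box 3 n) u v).card : ℝ) := by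
    intro n u hu ω
    have h : 1 ≤ ((box 3 n).filter fun v => ω ∈ openConnIn ↑(box 3 n) u v).card := by
      refine Finset.card_pos.2 ⟨u, Finset.mem_filter.2 ⟨hu, ?_⟩⟩
      rw [openConnIn_self_eq_univ (Finset.mem_coe.2 hu)]
      trivial
    exact_mod_cast h
  have ha3 : a < 3 := by
    by_contra h
    obtain ⟨n, hn, hn1⟩ := (h2.and (eventually_ge_atTop 1)).exists
    have hle : (n : ℝ) ^ (3 - a) ≤ 1 :=
      Real.rpow_le_one_of_one_le_of_nonpos (by exact_mod_cast hn1) (by linarith [not_lt.1 h])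
    have huniv : {ω : BondConfig (Site 3) | ∃ u ∈ box 3 n, (n : ℝ) ^ (3 - a) ≤
        (((box 3 n).filter fun v => ω ∈ openConnIn ↑(box 3 n) u v).card : ℝ)} = Set.univ :=
      Set.eq_univ_of_forall fun ω =>
        ⟨0, zero_mem_box 3 n, hle.trans (hN1 n 0 (zero_mem_box 3 n) ω)⟩
    rw [huniv, probReal_univ] at hn
    linarith
  -- parameters: `θ = max (1-ε) 0`, `M` with `1/M ≤ a/2`, `ρ = (3^M)^{-a/2}`, threshold `k₁`
  have hθ0 : (0 : ℝ) ≤ max (1 - ε) 0 := le_max_right _ _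
  have hθ1 : max (1 - ε) 0 < 1 := max_lt (by linarith) one_pos
  obtain ⟨M₀, hM₀⟩ := exists_nat_one_div_lt (half_pos ha)
  have hM : M₀ + 1 ≠ 0 := Nat.succ_ne_zero _
  have hMa : ((M₀ + 1 : ℕ) : ℝ)⁻¹ ≤ a / 2 := by
    rw [inv_eq_one_div]; push_cast; exact hM₀.le
  have hρ : (0 : ℝ) < ((3 : ℝ) ^ (M₀ + 1)) ^ (-(a / 2)) := Real.rpow_pos_of_pos (by positivity) _
  obtain ⟨k₁, hk₁⟩ := eventually_atTop.1 (eventually_pow_two_pow_le hθ0 hθ1 hρ)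
  have hb : 1 < 3 ^ (M₀ + 1) := Nat.one_lt_pow hM (by norm_num)
  refine ⟨a / 2, 2, half_pos ha, ?_⟩
  filter_upwards [h2, eventually_ge_atTop (max 1 ((3 ^ (M₀ + 1)) ^ k₁))] with n hn hn'
  have hn1 : 1 ≤ n := le_of_max_le_left hn'
  have hn0 : (0 : ℝ) < n := by exact_mod_cast hn1
  set k := Nat.log (3 ^ (M₀ + 1)) n with hk_def
  have hk : k₁ ≤ k := Nat.le_log_of_pow_le hb (le_of_max_le_right hn')
  have hbase : (1 : ℝ) ≤ (n : ℝ) ^ (3 - a) :=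
    Real.one_le_rpow (by exact_mod_cast hn1) (by linarith)
  -- (1) + (H2): the probabilistic term `q(3^k n^{3-a}) ≤ θ^{2^k} ≤ ρ^{k+1} ≤ n^{-a/2}`
  have hQ : q[p, n, (3 : ℝ) ^ k * (n : ℝ) ^ (3 - a)] ≤ (n : ℝ) ^ (-(a / 2)) := by
    have hiter : q[p, n, (3 : ℝ) ^ k * (n : ℝ) ^ (3 - a)] ≤
        q[p, n, (n : ℝ) ^ (3 - a)] ^ 2 ^ k :=
      iterate_sq (fun t => q[p, n, t]) (fun _ => measureReal_nonneg) (fun s hs => h1 n s hs)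
        hbase k
    calc q[p, n, (3 : ℝ) ^ k * (n : ℝ) ^ (3 - a)]
        ≤ q[p, n, (n : ℝ) ^ (3 - a)] ^ 2 ^ k := hiter
      _ ≤ (max (1 - ε) 0) ^ 2 ^ k :=
          pow_le_pow_left₀ measureReal_nonneg (hn.trans (le_max_left _ _)) _
      _ ≤ (((3 : ℝ) ^ (M₀ + 1)) ^ (-(a / 2))) ^ (k + 1) := hk₁ k hk
      _ ≤ (n : ℝ) ^ (-(a / 2)) := rho_pow_le ha.le hM hn1
  -- (2) first moment at `t = 3^k n^{3-a}`
  have hfm := sum_sum_measureReal_le (bondPercolation (zdGraph 3) p) (box 3 n)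
    (fun x y => openConnIn (↑(box 3 n) : Set (Site 3)) x y)
    (fun x _ y _ => DCT16.measurableSet_openConnIn (box 3 n) x y)
    (by positivity : (0 : ℝ) ≤ (3 : ℝ) ^ k * (n : ℝ) ^ (3 - a))
  beta_reduce at hfm
  -- (3) the deterministic term and the sum
  have hc := card_box_pos n
  have hc3 : (n : ℝ) ^ 3 ≤ ((box 3 n).card : ℝ) := by
    rw [card_box_real]
    gcongr
    linarith
  have hdet : (3 : ℝ) ^ k * (n : ℝ) ^ (3 - a) ≤ (n : ℝ) ^ (-(a / 2)) * ((box 3 n).card : ℝ) :=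
    (scale_term_le hM hMa hn1).trans
      (mul_le_mul_of_nonneg_left hc3 (Real.rpow_nonneg hn0.le _))
  rw [div_le_iff₀ (pow_pos hc 2)]
  calc _ ≤ _ := hfm
    _ ≤ ((box 3 n).card : ℝ) * ((n : ℝ) ^ (-(a / 2)) * ((box 3 n).card : ℝ)) +
          ((box 3 n).card : ℝ) ^ 2 * (n : ℝ) ^ (-(a / 2)) :=
        add_le_add (mul_le_mul_of_nonneg_left hdet hc.le)
          (mul_le_mul_of_nonneg_left hQ (pow_nonneg hc.le 2))
    _ = 2 * (n : ℝ) ^ (-(a / 2)) * ((box 3 n).card : ℝ) ^ 2 := by ring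

end Summit.CriticalPhenomena.PercolationContinuityZ3.FreeBoxPowerSavingLine

end
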